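import Summits.Ventures.HodgeRepro2.T6N43Toy

/-!
# T6N43Places — the three real places of N4.3 bundled, and THEOREM N4.3 as «∀ j» (Tier 6, M2; t6-p6)

Record formalised: TIER5 §N4.3 (route/T5-N4-p5.md v13; TIER5 v0.51 ll. 1241–1251): Proposition N* (N3)
hypothesis (i) at the three real places τ′₁, τ′₂, τ′₃ of the sextic CM field — «Z^*_{τ′_j}(1/2) ≠ 0,
j = 1, 2, 3» — with τ′₁ the compact place (`H = U(2)`, signature (0,2)) and τ′₂, τ′₃ the places of
signature (1,1) (`H = U(1,1)`). The two mains of T6N43Main.lean (`N43_main_U2` at τ′₁, `N43_main_U11`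
at τ′₂, τ′₃) are over ONE `ArchDoublingDatum` each; the lead's M2 composition carrier reads them «as
∀ j» (TARGET-T6.md §9.3, STATUS l. 4414 (2)). This file supplies that reading: the bundle `N43Places`
(one datum per place with its Eischen–Liu weight / twist parameters and, at the compact place, the
integer `m = (m′₁ − 3)/2` and the probability normalisation of the Haar measure — TIER5 l. 1251
«c₁ = 1» with the probability Haar measure on the compact `U(2)`), the value functions
`N43Places.zetaAt` / `N43Places.zetaStarAt : Fin 3 → ℂ`, and the theorem `N43_places` = THEOREM N4.3
(a)–(c) at all three places at once, consuming the displays `Hyp.Ruhl1970_A2f` (τ′₂, τ′₃) and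
`Hyp.EischenLiu2024_Sec2_2` (all three places) BY NAME and the interface Props of T6N43Datum.lean as
binders (ruling l. 4414 (q4); residual classes per route/T6-N43-t6-p6.md §9). The toy bundle
`N43Places.toy` (the accepted toys of T6N43Toy.lean at the three places) witnesses the binders jointly
(README §10.5(ii)(c)/(d)). One bundle per SIDE of the seesaw (side A and side B of (N4.3.P5)): the M2
carrier instantiates it twice. No display is declared here; nothing of Tiers 3–5 is re-opened.

§8(d): uses an L-value-free non-vanishing device: NO.
-/

namespace Summit.Ventures.HodgeRepro2.T6

open MeasureTheory Complex

/-- The three real places of N4.3 bundled: at the compact place τ′₁ an `ArchDoublingDatum` on a group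
presented in `U(2)` with the probability normalisation of its Haar measure and the integer
`m = (m′₁ − 3)/2` of (N4.3.P2)_{τ′₁}; at τ′₂ and τ′₃ an `ArchDoublingDatum` on a group presented in
`U(1,1)` (p1's `T5UnitaryBound.MemU11`); at every place the Eischen–Liu weight / twist parameters
`(τ; ν; r)` of the archimedean L-factor display (signature `(a, b) = (2, 0)` at τ′₁, `(1, 1)` at
τ′₂, τ′₃). Fields are DATA (and the normalisation of the compact Haar measure); the printed theorems
about them are the displays of T6N43Hyp.lean, consumed by name in `N43_places`. -/
structure N43Places where
  /-- the group carrier at the compact place τ′₁ -/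
  H₁ : Type
  /-- its measurable structure -/
  [meas₁ : MeasurableSpace H₁]
  /-- the local doubling datum at τ′₁ (matrices in `U(2)`) -/
  d₁ : ArchDoublingDatum H₁ (· ∈ Matrix.unitaryGroup (Fin 2) ℂ)
  /-- the Haar measure at the compact place is normalised to total mass 1 (TIER5 l. 1251) -/
  prob₁ : IsProbabilityMeasure d₁.μ
  /-- the integer `(m′₁ − 3)/2` of (N4.3.P2) at τ′₁ -/
  m : ℤ
  /-- the Eischen–Liu weight `τ` at τ′₁ (signature (2,0)) -/
  τ₁ : Fin 2 → ℤ
  /-- the Eischen–Liu weight `ν` at τ′₁ (signature (2,0): empty) -/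
  ν₁ : Fin 0 → ℤ
  /-- the Eischen–Liu twist `r` at τ′₁ -/
  r₁ : ℤ
  /-- the group carrier at the place τ′₂ -/
  H₂ : Type
  /-- its measurable structure -/
  [meas₂ : MeasurableSpace H₂]
  /-- the local doubling datum at τ′₂ (matrices in `U(1,1)`) -/
  d₂ : ArchDoublingDatum H₂ T5UnitaryBound.MemU11
  /-- the Eischen–Liu weight `τ` at τ′₂ (signature (1,1)) -/
  τ₂ : Fin 1 → ℤ
  /-- the Eischen–Liu weight `ν` at τ′₂ -/
  ν₂ : Fin 1 → ℤ
  /-- the Eischen–Liu twist `r` at τ′₂ -/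
  r₂ : ℤ
  /-- the group carrier at the place τ′₃ -/
  H₃ : Type
  /-- its measurable structure -/
  [meas₃ : MeasurableSpace H₃]
  /-- the local doubling datum at τ′₃ (matrices in `U(1,1)`) -/
  d₃ : ArchDoublingDatum H₃ T5UnitaryBound.MemU11
  /-- the Eischen–Liu weight `τ` at τ′₃ (signature (1,1)) -/
  τ₃ : Fin 1 → ℤ
  /-- the Eischen–Liu weight `ν` at τ′₃ -/
  ν₃ : Fin 1 → ℤ
  /-- the Eischen–Liu twist `r` at τ′₃ -/
  r₃ : ℤ

namespace N43Places

variable (D : N43Places)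

/-- The measurable structure of the carrier at τ′₁, as an instance. -/
instance instMeasurableSpaceH₁ : MeasurableSpace D.H₁ := D.meas₁
/-- The measurable structure of the carrier at τ′₂, as an instance. -/
instance instMeasurableSpaceH₂ : MeasurableSpace D.H₂ := D.meas₂
/-- The measurable structure of the carrier at τ′₃, as an instance. -/
instance instMeasurableSpaceH₃ : MeasurableSpace D.H₃ := D.meas₃

/-- The local doubling zeta value `Z_{τ′_j}(1/2)` at the `j`-th real place (`j = 0, 1, 2` ↔ τ′₁, τ′₂, τ′₃). -/
noncomputable def zetaAt : Fin 3 → ℂ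
  | 0 => D.d₁.zeta (1 / 2)
  | 1 => D.d₂.zeta (1 / 2)
  | 2 => D.d₃.zeta (1 / 2)

/-- The normalised local zeta value `Z^*_{τ′_j}(1/2) = Z_{τ′_j}(1/2) / L(1, π₀,τ′_j × χ_{V,τ′_j})` at the
`j`-th real place (GQT §11.6; `ArchDoublingDatum.zetaStar`). -/
noncomputable def zetaStarAt : Fin 3 → ℂ
  | 0 => D.d₁.zetaStar (1 / 2)
  | 1 => D.d₂.zetaStar (1 / 2)
  | 2 => D.d₃.zetaStar (1 / 2)

/-- Proposition N* (N3) hypothesis (i) at the archimedean places, in the form the M2 composition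
consumes (TARGET-T6.md §9.3, N4): «Z^*_{τ′_j}(1/2) ≠ 0 for j = 1, 2, 3». -/
def ArchNonvanishing : Prop := ∀ j : Fin 3, D.zetaStarAt j ≠ 0

/-- `zetaAt` at the compact place τ′₁ (`j = 0`). -/
theorem zetaAt_zero : D.zetaAt 0 = D.d₁.zeta (1 / 2) := rfl
/-- `zetaAt` at τ′₂ (`j = 1`). -/
theorem zetaAt_one : D.zetaAt 1 = D.d₂.zeta (1 / 2) := rfl
/-- `zetaAt` at τ′₃ (`j = 2`). -/
theorem zetaAt_two : D.zetaAt 2 = D.d₃.zeta (1 / 2) := rfl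
/-- `zetaStarAt` at the compact place τ′₁ (`j = 0`). -/
theorem zetaStarAt_zero : D.zetaStarAt 0 = D.d₁.zetaStar (1 / 2) := rfl
/-- `zetaStarAt` at τ′₂ (`j = 1`). -/
theorem zetaStarAt_one : D.zetaStarAt 1 = D.d₂.zetaStar (1 / 2) := rfl
/-- `zetaStarAt` at τ′₃ (`j = 2`). -/
theorem zetaStarAt_two : D.zetaStarAt 2 = D.d₃.zetaStar (1 / 2) := rfl

/-- THEOREM N4.3 (a)–(c) at ALL THREE real places (TIER5 ll. 1245–1251), read as «∀ j»: modulo the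
displays `Hyp.EischenLiu2024_Sec2_2` (at every place, with the bundle's weight / twist parameters) and
`Hyp.Ruhl1970_A2f` (at τ′₂, τ′₃) consumed by name, and the interface Props (N4.3.P2) / (N4.3.P2′)
(`FockLineIdentification`, `LowestWeightCoefficient` at τ′₂, τ′₃; `CharacterCoefficient` at τ′₁) —
`Z_{τ′_j}(1/2)` has positive real part and `Z^*_{τ′_j}(1/2) ≠ 0` for `j = 1, 2, 3`. The compact place is
`N43_main_U2`, the two others `N43_main_U11`. -/
theorem N43_places
    (hP2₁ : D.d₁.CharacterCoefficient D.m)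
    (hEL₁ : Hyp.EischenLiu2024_Sec2_2 2 0 D.τ₁ D.ν₁ D.r₁ D.d₁.Lfac)
    (hP2₂ : D.d₂.FockLineIdentification) (hP2'₂ : D.d₂.LowestWeightCoefficient)
    (hA2f₂ : Hyp.Ruhl1970_A2f D.d₂)
    (hEL₂ : Hyp.EischenLiu2024_Sec2_2 1 1 D.τ₂ D.ν₂ D.r₂ D.d₂.Lfac)
    (hP2₃ : D.d₃.FockLineIdentification) (hP2'₃ : D.d₃.LowestWeightCoefficient)
    (hA2f₃ : Hyp.Ruhl1970_A2f D.d₃)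
    (hEL₃ : Hyp.EischenLiu2024_Sec2_2 1 1 D.τ₃ D.ν₃ D.r₃ D.d₃.Lfac) :
    (∀ j : Fin 3, 0 < (D.zetaAt j).re) ∧ D.ArchNonvanishing := by
  have h₁ := D.d₁.N43_main_U2 D.prob₁ hP2₁ hEL₁
  have h₂ := D.d₂.N43_main_U11 hP2₂ hP2'₂ hA2f₂ hEL₂
  have h₃ := D.d₃.N43_main_U11 hP2₃ hP2'₃ hA2f₃ hEL₃
  refine ⟨fun j => ?_, fun j => ?_⟩
  · fin_cases j
    · exact h₁.1
    · exact h₂.1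
    · exact h₃.1
  · fin_cases j
    · exact h₁.2
    · exact h₂.2
    · exact h₃.2

/-- The archimedean non-vanishing alone (the conjunct the M2 carrier's `iA` / `iB` read). -/
theorem archNonvanishing
    (hP2₁ : D.d₁.CharacterCoefficient D.m)
    (hEL₁ : Hyp.EischenLiu2024_Sec2_2 2 0 D.τ₁ D.ν₁ D.r₁ D.d₁.Lfac)
    (hP2₂ : D.d₂.FockLineIdentification) (hP2'₂ : D.d₂.LowestWeightCoefficient)
    (hA2f₂ : Hyp.Ruhl1970_A2f D.d₂)
    (hEL₂ : Hyp.EischenLiu2024_Sec2_2 1 1 D.τ₂ D.ν₂ D.r₂ D.d₂.Lfac)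
    (hP2₃ : D.d₃.FockLineIdentification) (hP2'₃ : D.d₃.LowestWeightCoefficient)
    (hA2f₃ : Hyp.Ruhl1970_A2f D.d₃)
    (hEL₃ : Hyp.EischenLiu2024_Sec2_2 1 1 D.τ₃ D.ν₃ D.r₃ D.d₃.Lfac) :
    D.ArchNonvanishing :=
  (D.N43_places hP2₁ hEL₁ hP2₂ hP2'₂ hA2f₂ hEL₂ hP2₃ hP2'₃ hA2f₃ hEL₃).2

/-- The toy bundle: the accepted toys of T6N43Toy.lean at the three places (`toyU2` at τ′₁ with the
Dirac probability measure, `toyU11` = the Cartan line at τ′₂ and τ′₃), all weights `0`, twist `0`,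
`m = 0`. -/
noncomputable def toy : N43Places where
  H₁ := Unit
  d₁ := N43Toy.toyU2
  prob₁ := inferInstanceAs (IsProbabilityMeasure (Measure.dirac ()))
  m := 0
  τ₁ := 0
  ν₁ := 0
  r₁ := 0
  H₂ := ℝ
  d₂ := N43Toy.toyU11
  τ₂ := 0
  ν₂ := 0
  r₂ := 0
  H₃ := ℝ
  d₃ := N43Toy.toyU11
  τ₃ := 0
  ν₃ := 0
  r₃ := 0

/-- README §10.5(ii)(d) for `N43_places`: the ten binders are jointly satisfiable on the toy bundle. -/
theorem toy_binders_jointly_satisfiable :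
    toy.d₁.CharacterCoefficient toy.m ∧
    Hyp.EischenLiu2024_Sec2_2 2 0 toy.τ₁ toy.ν₁ toy.r₁ toy.d₁.Lfac ∧
    toy.d₂.FockLineIdentification ∧ toy.d₂.LowestWeightCoefficient ∧ Hyp.Ruhl1970_A2f toy.d₂ ∧
    Hyp.EischenLiu2024_Sec2_2 1 1 toy.τ₂ toy.ν₂ toy.r₂ toy.d₂.Lfac ∧
    toy.d₃.FockLineIdentification ∧ toy.d₃.LowestWeightCoefficient ∧ Hyp.Ruhl1970_A2f toy.d₃ ∧
    Hyp.EischenLiu2024_Sec2_2 1 1 toy.τ₃ toy.ν₃ toy.r₃ toy.d₃.Lfac :=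
  ⟨N43Toy.toyU2_char, N43Toy.toyU2_EL, N43Toy.toyU11_fock, N43Toy.toyU11_lowest, N43Toy.toyU11_A2f,
    N43Toy.toyU11_EL, N43Toy.toyU11_fock, N43Toy.toyU11_lowest, N43Toy.toyU11_A2f, N43Toy.toyU11_EL⟩

/-- The theorem applied to the toy bundle: `Z^*_{τ′_j}(1/2) ≠ 0` at all three places. -/
theorem toy_archNonvanishing : toy.ArchNonvanishing :=
  toy.archNonvanishing N43Toy.toyU2_char N43Toy.toyU2_EL N43Toy.toyU11_fock N43Toy.toyU11_lowest
    N43Toy.toyU11_A2f N43Toy.toyU11_EL N43Toy.toyU11_fock N43Toy.toyU11_lowest N43Toy.toyU11_A2f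
    N43Toy.toyU11_EL

end N43Places

end Summit.Ventures.HodgeRepro2.T6
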